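import Summits.QuantumFields.YangMills.Theorems.EntropyBudgetEquipartitionTwoSidedDlrAssembly
import HarnessLib

/-!
# Route `EntropyBudgetEquipartition`, crux `EntropyBudgetTransfer` (stmt-QuantumFields-22401) — helper:
# the two-sided DLR assembly ALONG THE ONE-SCALE FAMILY (`H = ⌈β^θ⌉`, `T = ⌈β^A⌉`), with the exponent bookkeeping done

HONEST LABEL: plumbing toward a RECORD-label rung (R2ξ-G, the all-`G` leaf `WeakCouplingRates.XiPow`, an UPPER bound on the
lattice gap); nothing here bears on the Yang–Mills mass gap.  No analysis and no Lie theory: the one-scale statements are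
HYPOTHESES.

`EntropyBudgetEquipartitionTwoSidedDlrAssembly.abs_sq_mul_torusPlaqCov_sub_le` bounds `|β²·torusPlaqCov ρ β L T 1 2 − Φ|` at ONE
`(β, H, T, L)` by `ε₁ + 2(C₁+M)τ + 2ε² + (2(2Nβ)² + |Φ| + (2Nβ+B)²)·6(2H+3)⁴e^{−β^δ}`.  This file runs it along the family of the
sibling line `dlr-chessboard-G` (`ColdBoxAllGroups`): box `H = ⌈β^θ⌉`, separation `T = ⌈β^A⌉`, crude-good threshold `β^{2δ−1}`,
kernel errors `ε₁ = β^{−θ/2}`, `ε = β^{−θ}` (the shapes of `KernelCovExpansionG` / `KernelMeanExpansionG`), a coherent-mode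
ceiling `M = C_M β^{2δ}` and a TYPICAL-BOUNDARY BUDGET `τ = β^{−κ₂}` (the entropy line's input, `EntropyBudgetEquipartitionModePricing`),
and proves:

* `twoSidedLaw_eventually_of_kernel_bounds` — on the window `2δ < κ₂` (and `0 < θ`, `0 < δ`), the torus two-point function of
  EVERY compact `G` obeys, for some `κ' > 0`, all `β ≥ β₀` and eventually in the torus size `L`,
  `|β²·torusPlaqCov ρ β L ⌈β^A⌉ 1 2 − Φ(β)| ≤ β^{−κ'}`,
  given: the large-field rarity `PlaquetteLargeFieldRarityG ρ δ` (LANDED for every `LatticeRep`,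
  `ColdBoxAllGroups.plaquetteLargeFieldRarityG_allSides`), measurable mode functionals `0 ≤ m_β, m'_β ≤ C_Mβ^{2δ}` of the datum,
  two-sided kernel bounds at crude-good data `|β²Cov_ω − Φ(β)| ≤ β^{−θ/2} + C₁(β)(m_β + m'_β)` (`0 ≤ C₁ ≤ 1`),
  `|βE_ω c_p − b(β) − m_β| ≤ β^{−θ}`, `|βE_ω c_q − b'(β) − m'_β| ≤ β^{−θ}` (`|Φ|, |b|, |b'| ≤ B₀`), and the budget
  `∫ m_β∘torusLift dμ_{L+1,β}, ∫ m'_β∘torusLift dμ_{L+1,β} ≤ β^{−κ₂}` eventually in `L`.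

`κ' = min(θ/2, κ₂ − 2δ)/2`.  With `Φ(β) = (D/2)·C_D(p,q)²` the landed kernel comparison
(`WeakCouplingRates.exists_boxDirichletPlaqCov_sub_bound`, `|C_D − C(T)| ≤ K/H⁴`) turns `Φ` into the crux's `σC(T)²`, `σ = D/2`.
So the crux at the separation `⌈β^A⌉` costs, beyond the sibling's two-sided one-scale interfaces, exactly the budget `τ`.
Written by width seat 2/3 (gen 3) of line `ym-line-ebe-p1` as `--supports stmt-QuantumFields-22401`.

References: H.-O. Georgii, *Gibbs Measures and Phase Transitions* (2011) Thm. 4.17; the sibling's one-sided template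
`ColdBoxAllGroups.stub_dlrAssemblyG`. [folklore]
-/

set_option autoImplicit false

noncomputable section

open MeasureTheory Filter Topology
open Literature.MathematicalPhysics
open Literature.MathematicalPhysics.QuantumFieldTheory
open Literature.MathematicalPhysics.QuantumLattice
open Summit.QuantumFields.YangMills.Theorems.WeakCouplingRates
open Summit.QuantumFields.YangMills.Theorems.ColdBoxAllGroups

namespace Summit.QuantumFields.YangMills.Theorems.EntropyBudgetEquipartition.TwoSidedDlr

variable {N : ℕ} {G : Type*} [Group G] [TopologicalSpace G] [IsTopologicalGroup G] [CompactSpace G]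
  [MeasurableSpace G] [BorelSpace G]

/-- **The two-sided law at separation `⌈β^A⌉`, eventually, from two-sided kernel bounds and a typical-boundary budget** (every
compact `G`; window `2δ < κ₂`).  See the module docstring for the shape of the hypotheses; the conclusion is
`∃ κ' > 0, ∃ β₀, ∀ β ≥ β₀, ∀ᶠ L, |β²·torusPlaqCov ρ β L ⌈β^A⌉ 1 2 − Φ(β)| ≤ β^{−κ'}` with `κ' = min(θ/2, κ₂ − 2δ)/2`.
(`abs_sq_mul_torusPlaqCov_sub_le` + the asymptotics `β^{s}e^{−β^δ} → 0`, `β^{−a} → 0`.) [cite: Georgii2011, Thm. 4.17] -/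
theorem twoSidedLaw_eventually_of_kernel_bounds [SecondCountableTopology G] (ρ : G →* Matrix (Fin N) (Fin N) ℂ)
    (hρ : Continuous ρ) (hρu : ∀ g, ρ g ∈ Matrix.unitaryGroup (Fin N) ℂ)
    {A θ δ κ₂ CM B₀ : ℝ} (hθ : 0 < θ) (hδ : 0 < δ) (hwin : 2 * δ < κ₂)
    (m m' : ℝ → LGConfig 4 G → ℝ) (hmm : ∀ β, Measurable (m β)) (hm'm : ∀ β, Measurable (m' β))
    (hm0 : ∀ β ω, 0 ≤ m β ω) (hmM : ∀ β ω, m β ω ≤ CM * β ^ (2 * δ))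
    (hm0' : ∀ β ω, 0 ≤ m' β ω) (hmM' : ∀ β ω, m' β ω ≤ CM * β ^ (2 * δ))
    (Φ b b' C₁ : ℝ → ℝ) (hΦ : ∀ β, |Φ β| ≤ B₀) (hb : ∀ β, |b β| ≤ B₀) (hb' : ∀ β, |b' β| ≤ B₀)
    (hC₁ : ∀ β, 0 ≤ C₁ β) (hC₁' : ∀ β, C₁ β ≤ 1)
    (hrar : PlaquetteLargeFieldRarityG ρ δ)
    (hcov : ∃ β₁ : ℝ, ∀ β : ℝ, β₁ ≤ β → ∀ ω : LGConfig 4 G, CrudeGoodG ρ β δ ⌈β ^ θ⌉₊ ω →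
      |β ^ 2 * ((∫ U, plaqCostAt ρ (boxCentre ⌈β ^ θ⌉₊) 1 2 U *
                plaqCostAt ρ (boxCentre ⌈β ^ θ⌉₊ + Pi.single 0 (⌈β ^ A⌉₊ : ℤ)) 1 2 U ∂(boxKernelG ρ β ⌈β ^ θ⌉₊ ω)) -
            (∫ U, plaqCostAt ρ (boxCentre ⌈β ^ θ⌉₊) 1 2 U ∂(boxKernelG ρ β ⌈β ^ θ⌉₊ ω)) *
              (∫ U, plaqCostAt ρ (boxCentre ⌈β ^ θ⌉₊ + Pi.single 0 (⌈β ^ A⌉₊ : ℤ)) 1 2 U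
                ∂(boxKernelG ρ β ⌈β ^ θ⌉₊ ω))) - Φ β|
        ≤ β ^ (-(θ / 2)) + C₁ β * (m β ω + m' β ω))
    (hmean : ∃ β₂ : ℝ, ∀ β : ℝ, β₂ ≤ β → ∀ ω : LGConfig 4 G, CrudeGoodG ρ β δ ⌈β ^ θ⌉₊ ω →
      |β * (∫ U, plaqCostAt ρ (boxCentre ⌈β ^ θ⌉₊) 1 2 U ∂(boxKernelG ρ β ⌈β ^ θ⌉₊ ω)) - b β - m β ω| ≤ β ^ (-θ) ∧
        |β * (∫ U, plaqCostAt ρ (boxCentre ⌈β ^ θ⌉₊ + Pi.single 0 (⌈β ^ A⌉₊ : ℤ)) 1 2 U ∂(boxKernelG ρ β ⌈β ^ θ⌉₊ ω)) -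
            b' β - m' β ω| ≤ β ^ (-θ))
    (htb : ∃ β₃ : ℝ, ∀ β : ℝ, β₃ ≤ β → ∀ᶠ L : ℕ in atTop,
      (∫ U, m β (torusLift (L + 1) U) ∂(wilsonMeasure (d := 4) (L := L + 1) ρ β)) ≤ β ^ (-κ₂) ∧
        (∫ U, m' β (torusLift (L + 1) U) ∂(wilsonMeasure (d := 4) (L := L + 1) ρ β)) ≤ β ^ (-κ₂)) :
    ∃ κ' : ℝ, 0 < κ' ∧ ∃ β₀ : ℝ, ∀ β : ℝ, β₀ ≤ β → ∀ᶠ L : ℕ in atTop,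
      |β ^ 2 * torusPlaqCov (d := 4) ρ β L ⌈β ^ A⌉₊ 1 2 - Φ β| ≤ β ^ (-κ') := by
  obtain ⟨β₁, hcov⟩ := hcov
  obtain ⟨β₂, hmean⟩ := hmean
  obtain ⟨β₃, htb⟩ := htb
  obtain ⟨β₄, hrar⟩ := hrar
  set Nr : ℝ := (N : ℝ) with hNr
  have hNr : 0 ≤ Nr := Nat.cast_nonneg _
  have hB₀ : 0 ≤ B₀ := (abs_nonneg _).trans (hΦ 0)
  -- the exponent
  set κ' : ℝ := min (θ / 2) (κ₂ - 2 * δ) / 2 with hκ'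
  have hκ'pos : 0 < κ' := by
    rw [hκ']; exact div_pos (lt_min (by linarith) (by linarith)) two_pos
  have hκ'1 : κ' - θ / 2 < 0 := by
    have : min (θ / 2) (κ₂ - 2 * δ) ≤ θ / 2 := min_le_left _ _
    rw [hκ']; linarith
  have hκ'2 : 2 * δ - κ₂ + κ' < 0 := by
    have : min (θ / 2) (κ₂ - 2 * δ) ≤ κ₂ - 2 * δ := min_le_right _ _
    rw [hκ']; linarith
  have hκ'3 : κ' - κ₂ < 0 := by linarith
  have hκ'4 : κ' - 2 * θ < 0 := by linarith
  -- the four error terms, each eventually `≤ ¼ β^{-κ'}` (stated as `term · β^{κ'} < ¼`)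
  have ev1 : ∀ᶠ β : ℝ in atTop, β ^ (κ' - θ / 2) < 1 / 4 := by
    have ht : Tendsto (fun β : ℝ => β ^ (κ' - θ / 2)) atTop (𝓝 0) := by
      have := tendsto_rpow_neg_atTop (show 0 < θ / 2 - κ' by linarith)
      refine this.congr' (Eventually.of_forall fun β => ?_); congr 1; ring
    exact ht.eventually (gt_mem_nhds (by norm_num))
  have ev2 : ∀ᶠ β : ℝ in atTop, 2 * β ^ (κ' - κ₂) + 2 * CM * β ^ (2 * δ - κ₂ + κ') < 1 / 4 := by
    have h1 : Tendsto (fun β : ℝ => 2 * β ^ (κ' - κ₂)) atTop (𝓝 (2 * 0)) := by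
      have := tendsto_rpow_neg_atTop (show 0 < κ₂ - κ' by linarith)
      refine (this.congr' (Eventually.of_forall fun β => ?_)).const_mul 2; congr 1; ring
    have h2 : Tendsto (fun β : ℝ => 2 * CM * β ^ (2 * δ - κ₂ + κ')) atTop (𝓝 (2 * CM * 0)) := by
      have := tendsto_rpow_neg_atTop (show 0 < κ₂ - 2 * δ - κ' by linarith)
      refine (this.congr' (Eventually.of_forall fun β => ?_)).const_mul (2 * CM); congr 1; ring
    rw [mul_zero] at h1 h2
    have := h1.add h2
    rw [add_zero] at this
    exact this.eventually (gt_mem_nhds (by norm_num))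
  have ev3 : ∀ᶠ β : ℝ in atTop, 2 * β ^ (κ' - 2 * θ) < 1 / 4 := by
    have h1 : Tendsto (fun β : ℝ => 2 * β ^ (κ' - 2 * θ)) atTop (𝓝 (2 * 0)) := by
      have := tendsto_rpow_neg_atTop (show 0 < 2 * θ - κ' by linarith)
      refine (this.congr' (Eventually.of_forall fun β => ?_)).const_mul 2; congr 1; ring
    rw [mul_zero] at h1
    exact h1.eventually (gt_mem_nhds (by norm_num))
  set Cbad : ℝ := (16 * Nr ^ 2 + B₀ + 2 * B₀ ^ 2) * (6 * 2401) with hCbad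
  have hCbad0 : 0 ≤ Cbad := by positivity
  have ev4 : ∀ᶠ β : ℝ in atTop, Cbad * (β ^ (2 + 4 * θ + κ') * Real.exp (-(β ^ δ))) < 1 / 4 := by
    have ht := (tendsto_rpow_mul_exp_neg_rpow (2 + 4 * θ + κ') hδ).const_mul Cbad
    rw [mul_zero] at ht
    exact ht.eventually (gt_mem_nhds (by norm_num))
  obtain ⟨β₅, hβ₅⟩ := Filter.eventually_atTop.1 ((ev1.and ev2).and (ev3.and ev4))
  refine ⟨κ', hκ'pos, max (max (max β₁ β₂) (max β₃ β₄)) (max β₅ 1), fun β hβ => ?_⟩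
  simp only [max_le_iff] at hβ
  obtain ⟨⟨⟨hb1, hb2⟩, hb3, hb4⟩, hb5, hb6⟩ := hβ
  have hβ0 : 0 < β := by linarith
  obtain ⟨⟨hA1, hA2⟩, hA3, hA4⟩ := hβ₅ β hb5
  set H : ℕ := ⌈β ^ θ⌉₊ with hH
  set T : ℕ := ⌈β ^ A⌉₊ with hT
  -- sizes of `H`
  have hθpos : 0 < β ^ θ := Real.rpow_pos_of_pos hβ0 θ
  have hθ1 : (1 : ℝ) ≤ β ^ θ := Real.one_le_rpow hb6 hθ.le
  have hHle : (H : ℝ) ≤ 2 * β ^ θ := by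
    have h1 : (H : ℝ) < β ^ θ + 1 := Nat.ceil_lt_add_one hθpos.le
    linarith
  -- bookkeeping (depends on `β` only): each of the four error terms is at most `¼ β^{-κ'}`
  have hk0 : 0 < β ^ (-κ') := Real.rpow_pos_of_pos hβ0 _
  have hsplit : ∀ s : ℝ, β ^ s = β ^ (s + κ') * β ^ (-κ') := fun s => by
    rw [← Real.rpow_add hβ0]; ring_nf
  -- term 1
  have t1 : β ^ (-(θ / 2)) ≤ 1 / 4 * β ^ (-κ') := by
    rw [hsplit (-(θ / 2)), show -(θ / 2) + κ' = κ' - θ / 2 by ring]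
    exact mul_le_mul_of_nonneg_right hA1.le hk0.le
  -- term 2
  have t2 : 2 * (C₁ β + CM * β ^ (2 * δ)) * β ^ (-κ₂) ≤ 1 / 4 * β ^ (-κ') := by
    have h1 : 2 * (C₁ β + CM * β ^ (2 * δ)) * β ^ (-κ₂) ≤ 2 * (1 + CM * β ^ (2 * δ)) * β ^ (-κ₂) := by
      have : C₁ β + CM * β ^ (2 * δ) ≤ 1 + CM * β ^ (2 * δ) := by linarith [hC₁' β]
      exact mul_le_mul_of_nonneg_right (mul_le_mul_of_nonneg_left this two_pos.le) (Real.rpow_nonneg hβ0.le _)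
    have e1 : β ^ (κ' - κ₂) * β ^ (-κ') = β ^ (-κ₂) := by
      rw [← Real.rpow_add hβ0]; ring_nf
    have e2 : β ^ (2 * δ - κ₂ + κ') * β ^ (-κ') = β ^ (2 * δ) * β ^ (-κ₂) := by
      rw [← Real.rpow_add hβ0, ← Real.rpow_add hβ0]; ring_nf
    have h2 : 2 * (1 + CM * β ^ (2 * δ)) * β ^ (-κ₂) =
        (2 * β ^ (κ' - κ₂) + 2 * CM * β ^ (2 * δ - κ₂ + κ')) * β ^ (-κ') := by
      rw [add_mul (2 * β ^ (κ' - κ₂)), mul_assoc 2 (β ^ (κ' - κ₂)), e1, mul_assoc (2 * CM), e2]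
      ring
    rw [h2] at h1
    exact h1.trans (mul_le_mul_of_nonneg_right hA2.le hk0.le)
  -- term 3
  have t3 : 2 * (β ^ (-θ)) ^ 2 ≤ 1 / 4 * β ^ (-κ') := by
    have e : (β ^ (-θ)) ^ 2 = β ^ (κ' - 2 * θ) * β ^ (-κ') := by
      rw [← Real.rpow_natCast (β ^ (-θ)) 2, ← Real.rpow_mul hβ0.le, ← Real.rpow_add hβ0]
      congr 1; push_cast; ring
    rw [e, ← mul_assoc]
    exact mul_le_mul_of_nonneg_right hA3.le hk0.le
  -- term 4 (the bad event)
  have t4 : (2 * (2 * Nr * β) ^ 2 + |Φ β| + (2 * Nr * β + B₀) ^ 2) *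
      (((6 * (2 * H + 3) ^ 4 : ℕ) : ℝ) * Real.exp (-(β ^ δ))) ≤ 1 / 4 * β ^ (-κ') := by
    have hβ2 : (1 : ℝ) ≤ β ^ 2 := one_le_pow₀ hb6
    have hcoef : 2 * (2 * Nr * β) ^ 2 + |Φ β| + (2 * Nr * β + B₀) ^ 2 ≤ (16 * Nr ^ 2 + B₀ + 2 * B₀ ^ 2) * β ^ 2 := by
      have h1 : (2 * Nr * β + B₀) ^ 2 ≤ 2 * (2 * Nr * β) ^ 2 + 2 * B₀ ^ 2 := by
        nlinarith [sq_nonneg (2 * Nr * β - B₀)]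
      have h2 : |Φ β| ≤ B₀ * β ^ 2 := (hΦ β).trans (le_mul_of_one_le_right hB₀ hβ2)
      have h3 : 2 * B₀ ^ 2 ≤ 2 * B₀ ^ 2 * β ^ 2 := le_mul_of_one_le_right (by positivity) hβ2
      have e : 2 * (2 * Nr * β) ^ 2 = 8 * Nr ^ 2 * β ^ 2 := by ring
      have e' : (16 * Nr ^ 2 + B₀ + 2 * B₀ ^ 2) * β ^ 2 = 8 * Nr ^ 2 * β ^ 2 + 8 * Nr ^ 2 * β ^ 2 + B₀ * β ^ 2 +
          2 * B₀ ^ 2 * β ^ 2 := by ring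
      rw [e'] ; rw [e] at h1 ⊢
      linarith
    have hH4 : ((6 * (2 * H + 3) ^ 4 : ℕ) : ℝ) ≤ 6 * 2401 * β ^ (4 * θ) := by
      have h7 : (2 * (H : ℝ) + 3) ≤ 7 * β ^ θ := by linarith
      have h74 : (2 * (H : ℝ) + 3) ^ 4 ≤ (7 * β ^ θ) ^ 4 := pow_le_pow_left₀ (by positivity) h7 4
      have e4 : (β ^ θ) ^ 4 = β ^ (4 * θ) := by
        rw [← Real.rpow_natCast (β ^ θ) 4, ← Real.rpow_mul hβ0.le]; norm_num; ring_nf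
      push_cast
      rw [mul_pow, e4] at h74
      linarith
    have hsplit2 : β ^ 2 * β ^ (4 * θ) = β ^ (2 + 4 * θ + κ') * β ^ (-κ') := by
      rw [← Real.rpow_natCast β 2, ← Real.rpow_add hβ0, ← Real.rpow_add hβ0]; push_cast; ring_nf
    have hexp0 : 0 ≤ Real.exp (-(β ^ δ)) := (Real.exp_pos _).le
    calc (2 * (2 * Nr * β) ^ 2 + |Φ β| + (2 * Nr * β + B₀) ^ 2) * (((6 * (2 * H + 3) ^ 4 : ℕ) : ℝ) * Real.exp (-(β ^ δ)))
        ≤ ((16 * Nr ^ 2 + B₀ + 2 * B₀ ^ 2) * β ^ 2) * (6 * 2401 * β ^ (4 * θ) * Real.exp (-(β ^ δ))) :=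
          mul_le_mul hcoef (mul_le_mul_of_nonneg_right hH4 hexp0) (by positivity) (by positivity)
      _ = Cbad * (β ^ (2 + 4 * θ + κ') * Real.exp (-(β ^ δ))) * β ^ (-κ') := by
          rw [hCbad]
          have : (16 * Nr ^ 2 + B₀ + 2 * B₀ ^ 2) * β ^ 2 * (6 * 2401 * β ^ (4 * θ) * Real.exp (-(β ^ δ))) =
              (16 * Nr ^ 2 + B₀ + 2 * B₀ ^ 2) * (6 * 2401) * ((β ^ 2 * β ^ (4 * θ)) * Real.exp (-(β ^ δ))) := by ring
          rw [this, hsplit2]; ring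
      _ ≤ 1 / 4 * β ^ (-κ') := mul_le_mul_of_nonneg_right hA4.le hk0.le
  have hbook : β ^ (-(θ / 2)) + 2 * (C₁ β + CM * β ^ (2 * δ)) * β ^ (-κ₂) + 2 * (β ^ (-θ)) ^ 2 +
      (2 * (2 * Nr * β) ^ 2 + |Φ β| + (2 * Nr * β + B₀) ^ 2) *
        (((6 * (2 * H + 3) ^ 4 : ℕ) : ℝ) * Real.exp (-(β ^ δ))) ≤ β ^ (-κ') := by
    have hsum := add_le_add (add_le_add (add_le_add t1 t2) t3) t4
    linarith
  -- eventually in the torus size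
  filter_upwards [hrar β hb4, htb β hb3, eventually_gt_atTop (2 * (2 * H + T + 2))] with L hL2 hLtb hLbig
  obtain ⟨hτ, hτ'⟩ := hLtb
  -- the one-`(β, H, T, L)` assembly
  have main := abs_sq_mul_torusPlaqCov_sub_le ρ hρ hρu hβ0.le (Nat.lt_succ_of_lt hLbig) hL2 (hmm β) (hm'm β)
    (M := CM * β ^ (2 * δ)) (Φ := Φ β) (b₀ := b β) (b₀' := b' β) (B := B₀) (ε := β ^ (-θ)) (ε₁ := β ^ (-(θ / 2)))
    (C₁ := C₁ β) (τ := β ^ (-κ₂))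
    (fun ω => hm0 β ω) (fun ω => hmM β ω) (fun ω => hm0' β ω) (fun ω => hmM' β ω) (hb β) (hb' β)
    (Real.rpow_nonneg hβ0.le _) (hC₁ β) (hcov β hb1) (fun ω hω => (hmean β hb2 ω hω).1)
    (fun ω hω => (hmean β hb2 ω hω).2) hτ hτ'
  exact main.trans hbook

end Summit.QuantumFields.YangMills.Theorems.EntropyBudgetEquipartition.TwoSidedDlr

end
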